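import Summits.Ventures.Crystal3D.Theorems.StickyWulffConstantNoReconstructionGainPredSlotBudgetRaisedThreeFrameCore
import Summits.Ventures.Crystal3D.Theorems.StickyWulffConstantNoReconstructionGainPredSlotBudgetRaised
import HarnessLib

/-!
# The pred-slot budget with a raised up bond: exactly three contacts (B1b₃)

HONEST FRAMING. Part of the venture `Summits/Ventures/Crystal3D` (cell `crystal3d-full`), supports the
crux `NoReconstructionGain` (stmt-Ventures-19144, route `route-Ventures-StickyWulffConstant`), line
`adhesion` (wulff-p1 g15).  THE REGISTERED BRICK B1b₃ `predSlotBudget_of_upBond_raised_three` of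
skeleton v21 (memo RAISED-g14.md §4), by name: a lattice frame whose axis is within `70.5°` of `−ν`, with
one of the three up bonds `ν`-raised, and exactly three contacts at lattice angles, satisfies the
pred-slot budget `#K ≤ Σ credits`.  Letter `+1` in the frame `A`, letter `−1` in the half-turn frame
`A ∘ R_π` (`halfTurn_bonds`); the raised bond is rotated to `w₃` (`rot120_bonds`,
`predSlotBudget_coreR_three`, `…_w1`, `…_w2`) exactly as for B1b₂ (`…PredSlotBudgetRaised`).

WHAT THIS IS NOT: the assembly `stub_predSlotBudget70` / `barlowGrainFilm_slab70` (skeleton); rung F-C1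
not moved by this file alone.
-/

noncomputable section

namespace Summit.Ventures.Crystal3D.Theorems

open Summit.Ventures.Crystal3D Finset
open Literature.MathematicalPhysics.StatisticalMechanics (fccStacking barlowPos constHagg barlowPos_mem
  threeOffsets barlowPos_apply_zero barlowPos_apply_one barlowPos_apply_two haggLabel_const)
open Literature.Algebra.EuclideanLattices (inner_fin_three norm_sq_fin_three)
open scoped InnerProductSpace

/-! ### The raised bond in the other two positions -/

/-- **CORE (three contacts), raised `w₁`** — from the raised-`w₃` core in the frame `A ∘ g` (`rot120_bonds`). -/
theorem predSlotBudget_coreR_three_w1 (A : EuclideanSpace ℝ (Fin 3) ≃ₗᵢ[ℝ] EuclideanSpace ℝ (Fin 3))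
    (ν : EuclideanSpace ℝ (Fin 3)) (hν : ‖ν‖ = 1)
    (haxis : ⟪ν, A (EuclideanSpace.single (2 : Fin 3) (1 : ℝ))⟫_ℝ ≤ -(1 / 3)) (t : ℝ) (ht : 0 < t)
    (K : Finset (EuclideanSpace ℝ (Fin 3))) (hK : K.card = 3)
    (hK1 : ∀ u ∈ K, ‖u‖ = 1 ∧ ⟪u, ν⟫_ℝ ≤ -t) (hK2 : ∀ u ∈ K, ∀ u' ∈ K, u ≠ u' → ⟪u, u'⟫_ℝ ≤ 1 / 2)
    (g₁ g₂ g₃ : EuclideanSpace ℝ (Fin 3))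
    (hg₁ : g₁ = A (barlowPos 1 (Real.sqrt (2 / 3)) constHagg 0 1 0) ∨ g₁ = -A (barlowPos 1 (Real.sqrt (2 / 3)) constHagg 0 1 0))
    (hg₂ : g₂ = A (barlowPos 1 (Real.sqrt (2 / 3)) constHagg 0 0 1) ∨ g₂ = -A (barlowPos 1 (Real.sqrt (2 / 3)) constHagg 0 0 1))
    (hg₃ : g₃ = A (barlowPos 1 (Real.sqrt (2 / 3)) constHagg 0 1 (-1)) ∨ g₃ = -A (barlowPos 1 (Real.sqrt (2 / 3)) constHagg 0 1 (-1)))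
    (hraised : 0 ≤ ⟪A (barlowPos 1 (Real.sqrt (2 / 3)) constHagg 1 0 0), ν⟫_ℝ) :
    (K.card : ℝ) ≤
      (if (∃ u ∈ K, 1 / 2 < ⟪u, if ⟪g₁, ν⟫_ℝ < 0 then g₁ else -g₁⟫_ℝ) ∨
          ⟪(if ⟪g₁, ν⟫_ℝ < 0 then g₁ else -g₁), ν⟫_ℝ ≤ -t then (1 : ℝ) else 0) +
      (if (∃ u ∈ K, 1 / 2 < ⟪u, if ⟪g₂, ν⟫_ℝ < 0 then g₂ else -g₂⟫_ℝ) ∨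
          ⟪(if ⟪g₂, ν⟫_ℝ < 0 then g₂ else -g₂), ν⟫_ℝ ≤ -t then (1 : ℝ) else 0) +
      (if (∃ u ∈ K, 1 / 2 < ⟪u, if ⟪g₃, ν⟫_ℝ < 0 then g₃ else -g₃⟫_ℝ) ∨
          ⟪(if ⟪g₃, ν⟫_ℝ < 0 then g₃ else -g₃), ν⟫_ℝ ≤ -t then (1 : ℝ) else 0) +
      (if (∃ u ∈ K, 1 / 2 < ⟪u, A (barlowPos 1 (Real.sqrt (2 / 3)) constHagg 1 0 0)⟫_ℝ) ∨ ⟪A (barlowPos 1 (Real.sqrt (2 / 3)) constHagg 1 0 0), ν⟫_ℝ ≤ -t then (1 : ℝ) else 0) +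
      (if (∃ u ∈ K, 1 / 2 < ⟪u, A (barlowPos 1 (Real.sqrt (2 / 3)) constHagg 1 (-1) 0)⟫_ℝ) ∨ ⟪A (barlowPos 1 (Real.sqrt (2 / 3)) constHagg 1 (-1) 0), ν⟫_ℝ ≤ -t then (1 : ℝ) else 0) +
      (if (∃ u ∈ K, 1 / 2 < ⟪u, A (barlowPos 1 (Real.sqrt (2 / 3)) constHagg 1 0 (-1))⟫_ℝ) ∨ ⟪A (barlowPos 1 (Real.sqrt (2 / 3)) constHagg 1 0 (-1)), ν⟫_ℝ ≤ -t then (1 : ℝ) else 0) := by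
  obtain ⟨r₁, r₂, r₃, q₁, q₂, q₃, re⟩ := rot120_bonds
  set g := (((ℝ ∙ (barlowPos 1 (Real.sqrt (2 / 3)) constHagg 0 1 0))ᗮ.reflection).trans ((ℝ ∙ (barlowPos 1 (Real.sqrt (2 / 3)) constHagg 0 0 1))ᗮ.reflection)) with hg
  have e1 : (g.trans A) (barlowPos 1 (Real.sqrt (2 / 3)) constHagg 0 1 0) = -A (barlowPos 1 (Real.sqrt (2 / 3)) constHagg 0 1 (-1)) := by
    rw [LinearIsometryEquiv.trans_apply, q₁, map_neg]
  have e2 : (g.trans A) (barlowPos 1 (Real.sqrt (2 / 3)) constHagg 0 0 1) = -A (barlowPos 1 (Real.sqrt (2 / 3)) constHagg 0 1 0) := by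
    rw [LinearIsometryEquiv.trans_apply, q₂, map_neg]
  have e3 : (g.trans A) (barlowPos 1 (Real.sqrt (2 / 3)) constHagg 0 1 (-1)) = A (barlowPos 1 (Real.sqrt (2 / 3)) constHagg 0 0 1) := by
    rw [LinearIsometryEquiv.trans_apply, q₃]
  have hc := predSlotBudget_coreR_three (g.trans A) ν hν
    (by rw [LinearIsometryEquiv.trans_apply, re]; exact haxis) t ht K hK hK1 hK2 g₃ g₁ g₂
    (hg₃.symm.imp (fun h => by rw [h, e1]) (fun h => by rw [h, e1, neg_neg]))
    (hg₁.symm.imp (fun h => by rw [h, e2]) (fun h => by rw [h, e2, neg_neg]))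
    (hg₂.imp (fun h => by rw [h, e3]) (fun h => by rw [h, e3]))
    (by rw [LinearIsometryEquiv.trans_apply, r₃]; exact hraised)
  simp only [LinearIsometryEquiv.trans_apply, r₁, r₂, r₃] at hc
  linarith only [hc]

/-- **CORE (three contacts), raised `w₂`** — from the raised-`w₃` core in the frame `A ∘ g ∘ g`. -/
theorem predSlotBudget_coreR_three_w2 (A : EuclideanSpace ℝ (Fin 3) ≃ₗᵢ[ℝ] EuclideanSpace ℝ (Fin 3))
    (ν : EuclideanSpace ℝ (Fin 3)) (hν : ‖ν‖ = 1)
    (haxis : ⟪ν, A (EuclideanSpace.single (2 : Fin 3) (1 : ℝ))⟫_ℝ ≤ -(1 / 3)) (t : ℝ) (ht : 0 < t)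
    (K : Finset (EuclideanSpace ℝ (Fin 3))) (hK : K.card = 3)
    (hK1 : ∀ u ∈ K, ‖u‖ = 1 ∧ ⟪u, ν⟫_ℝ ≤ -t) (hK2 : ∀ u ∈ K, ∀ u' ∈ K, u ≠ u' → ⟪u, u'⟫_ℝ ≤ 1 / 2)
    (g₁ g₂ g₃ : EuclideanSpace ℝ (Fin 3))
    (hg₁ : g₁ = A (barlowPos 1 (Real.sqrt (2 / 3)) constHagg 0 1 0) ∨ g₁ = -A (barlowPos 1 (Real.sqrt (2 / 3)) constHagg 0 1 0))
    (hg₂ : g₂ = A (barlowPos 1 (Real.sqrt (2 / 3)) constHagg 0 0 1) ∨ g₂ = -A (barlowPos 1 (Real.sqrt (2 / 3)) constHagg 0 0 1))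
    (hg₃ : g₃ = A (barlowPos 1 (Real.sqrt (2 / 3)) constHagg 0 1 (-1)) ∨ g₃ = -A (barlowPos 1 (Real.sqrt (2 / 3)) constHagg 0 1 (-1)))
    (hraised : 0 ≤ ⟪A (barlowPos 1 (Real.sqrt (2 / 3)) constHagg 1 (-1) 0), ν⟫_ℝ) :
    (K.card : ℝ) ≤
      (if (∃ u ∈ K, 1 / 2 < ⟪u, if ⟪g₁, ν⟫_ℝ < 0 then g₁ else -g₁⟫_ℝ) ∨
          ⟪(if ⟪g₁, ν⟫_ℝ < 0 then g₁ else -g₁), ν⟫_ℝ ≤ -t then (1 : ℝ) else 0) +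
      (if (∃ u ∈ K, 1 / 2 < ⟪u, if ⟪g₂, ν⟫_ℝ < 0 then g₂ else -g₂⟫_ℝ) ∨
          ⟪(if ⟪g₂, ν⟫_ℝ < 0 then g₂ else -g₂), ν⟫_ℝ ≤ -t then (1 : ℝ) else 0) +
      (if (∃ u ∈ K, 1 / 2 < ⟪u, if ⟪g₃, ν⟫_ℝ < 0 then g₃ else -g₃⟫_ℝ) ∨
          ⟪(if ⟪g₃, ν⟫_ℝ < 0 then g₃ else -g₃), ν⟫_ℝ ≤ -t then (1 : ℝ) else 0) +
      (if (∃ u ∈ K, 1 / 2 < ⟪u, A (barlowPos 1 (Real.sqrt (2 / 3)) constHagg 1 0 0)⟫_ℝ) ∨ ⟪A (barlowPos 1 (Real.sqrt (2 / 3)) constHagg 1 0 0), ν⟫_ℝ ≤ -t then (1 : ℝ) else 0) +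
      (if (∃ u ∈ K, 1 / 2 < ⟪u, A (barlowPos 1 (Real.sqrt (2 / 3)) constHagg 1 (-1) 0)⟫_ℝ) ∨ ⟪A (barlowPos 1 (Real.sqrt (2 / 3)) constHagg 1 (-1) 0), ν⟫_ℝ ≤ -t then (1 : ℝ) else 0) +
      (if (∃ u ∈ K, 1 / 2 < ⟪u, A (barlowPos 1 (Real.sqrt (2 / 3)) constHagg 1 0 (-1))⟫_ℝ) ∨ ⟪A (barlowPos 1 (Real.sqrt (2 / 3)) constHagg 1 0 (-1)), ν⟫_ℝ ≤ -t then (1 : ℝ) else 0) := by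
  obtain ⟨r₁, r₂, r₃, q₁, q₂, q₃, re⟩ := rot120_bonds
  set g := (((ℝ ∙ (barlowPos 1 (Real.sqrt (2 / 3)) constHagg 0 1 0))ᗮ.reflection).trans ((ℝ ∙ (barlowPos 1 (Real.sqrt (2 / 3)) constHagg 0 0 1))ᗮ.reflection)) with hg
  have e1 : ((g.trans g).trans A) (barlowPos 1 (Real.sqrt (2 / 3)) constHagg 0 1 0) = -A (barlowPos 1 (Real.sqrt (2 / 3)) constHagg 0 0 1) := by
    rw [LinearIsometryEquiv.trans_apply, LinearIsometryEquiv.trans_apply, q₁, map_neg, q₃, map_neg]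
  have e2 : ((g.trans g).trans A) (barlowPos 1 (Real.sqrt (2 / 3)) constHagg 0 0 1) = A (barlowPos 1 (Real.sqrt (2 / 3)) constHagg 0 1 (-1)) := by
    rw [LinearIsometryEquiv.trans_apply, LinearIsometryEquiv.trans_apply, q₂, map_neg, q₁, neg_neg]
  have e3 : ((g.trans g).trans A) (barlowPos 1 (Real.sqrt (2 / 3)) constHagg 0 1 (-1)) = -A (barlowPos 1 (Real.sqrt (2 / 3)) constHagg 0 1 0) := by
    rw [LinearIsometryEquiv.trans_apply, LinearIsometryEquiv.trans_apply, q₃, q₂, map_neg]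
  have hc := predSlotBudget_coreR_three ((g.trans g).trans A) ν hν
    (by rw [LinearIsometryEquiv.trans_apply, LinearIsometryEquiv.trans_apply, re, re]; exact haxis) t ht K hK hK1 hK2
    g₂ g₃ g₁
    (hg₂.symm.imp (fun h => by rw [h, e1]) (fun h => by rw [h, e1, neg_neg]))
    (hg₃.imp (fun h => by rw [h, e2]) (fun h => by rw [h, e2]))
    (hg₁.symm.imp (fun h => by rw [h, e3]) (fun h => by rw [h, e3, neg_neg]))
    (by rw [LinearIsometryEquiv.trans_apply, LinearIsometryEquiv.trans_apply, r₃, r₁]; exact hraised)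
  simp only [LinearIsometryEquiv.trans_apply, r₁, r₂, r₃] at hc
  linarith only [hc]

/-! ### The registered brick B1b₃ -/

/-- **THE PRED-SLOT BUDGET WITH A RAISED UP BOND, EXACTLY THREE CONTACTS** (the registered brick
`predSlotBudget_of_upBond_raised_three` of skeleton v21, by name). -/
theorem predSlotBudget_of_upBond_raised_three :
    ∀ A : EuclideanSpace ℝ (Fin 3) ≃ₗᵢ[ℝ] EuclideanSpace ℝ (Fin 3), ∀ ν : EuclideanSpace ℝ (Fin 3), ‖ν‖ = 1 →
      ⟪ν, A (EuclideanSpace.single (2 : Fin 3) (1 : ℝ))⟫_ℝ ≤ -(1 / 3) →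
      ∀ t : ℝ, 0 < t → ∀ K : Finset (EuclideanSpace ℝ (Fin 3)), K.card ≤ 3 →
        (∀ u ∈ K, ‖u‖ = 1 ∧ ⟪u, ν⟫_ℝ ≤ -t) →
        (∀ u ∈ K, ∀ u' ∈ K, u ≠ u' →
          ⟪u, u'⟫_ℝ = 1 / 2 ∨ ⟪u, u'⟫_ℝ = 0 ∨ ⟪u, u'⟫_ℝ = -1 / 2) →
        ∀ ε : ℤ, (ε = 1 ∨ ε = -1) →
        (∃ o ∈ threeOffsets (-ε),
          0 ≤ ⟪A (barlowPos 1 (Real.sqrt (2 / 3)) (fun _ : ℤ => ε) 1 (-o.1) (-o.2)), ν⟫_ℝ) →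
        K.card = 3 →
        (K.card : ℝ) ≤
          (if (∃ u ∈ K, 1 / 2 < ⟪u, if ⟪A (barlowPos 1 (Real.sqrt (2 / 3)) constHagg 0 1 0), ν⟫_ℝ < 0
                then A (barlowPos 1 (Real.sqrt (2 / 3)) constHagg 0 1 0)
                else -A (barlowPos 1 (Real.sqrt (2 / 3)) constHagg 0 1 0)⟫_ℝ) ∨
              ⟪(if ⟪A (barlowPos 1 (Real.sqrt (2 / 3)) constHagg 0 1 0), ν⟫_ℝ < 0
                then A (barlowPos 1 (Real.sqrt (2 / 3)) constHagg 0 1 0)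
                else -A (barlowPos 1 (Real.sqrt (2 / 3)) constHagg 0 1 0)), ν⟫_ℝ ≤ -t
            then (1 : ℝ) else 0) +
          (if (∃ u ∈ K, 1 / 2 < ⟪u, if ⟪A (barlowPos 1 (Real.sqrt (2 / 3)) constHagg 0 0 1), ν⟫_ℝ < 0
                then A (barlowPos 1 (Real.sqrt (2 / 3)) constHagg 0 0 1)
                else -A (barlowPos 1 (Real.sqrt (2 / 3)) constHagg 0 0 1)⟫_ℝ) ∨
              ⟪(if ⟪A (barlowPos 1 (Real.sqrt (2 / 3)) constHagg 0 0 1), ν⟫_ℝ < 0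
                then A (barlowPos 1 (Real.sqrt (2 / 3)) constHagg 0 0 1)
                else -A (barlowPos 1 (Real.sqrt (2 / 3)) constHagg 0 0 1)), ν⟫_ℝ ≤ -t
            then (1 : ℝ) else 0) +
          (if (∃ u ∈ K, 1 / 2 < ⟪u, if ⟪A (barlowPos 1 (Real.sqrt (2 / 3)) constHagg 0 1 (-1)), ν⟫_ℝ < 0
                then A (barlowPos 1 (Real.sqrt (2 / 3)) constHagg 0 1 (-1))
                else -A (barlowPos 1 (Real.sqrt (2 / 3)) constHagg 0 1 (-1))⟫_ℝ) ∨
              ⟪(if ⟪A (barlowPos 1 (Real.sqrt (2 / 3)) constHagg 0 1 (-1)), ν⟫_ℝ < 0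
                then A (barlowPos 1 (Real.sqrt (2 / 3)) constHagg 0 1 (-1))
                else -A (barlowPos 1 (Real.sqrt (2 / 3)) constHagg 0 1 (-1))), ν⟫_ℝ ≤ -t
            then (1 : ℝ) else 0) +
          (((threeOffsets (-ε)).filter fun o =>
            (∃ u ∈ K, 1 / 2 < ⟪u, A (barlowPos 1 (Real.sqrt (2 / 3)) (fun _ : ℤ => ε) 1 (-o.1) (-o.2))⟫_ℝ) ∨
              ⟪A (barlowPos 1 (Real.sqrt (2 / 3)) (fun _ : ℤ => ε) 1 (-o.1) (-o.2)), ν⟫_ℝ ≤ -t).card : ℝ) := by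
  intro A ν hν haxis t ht K hK hK1 hK2 ε hε hraised hK3
  have hK2' : ∀ u ∈ K, ∀ u' ∈ K, u ≠ u' → ⟪u, u'⟫_ℝ ≤ 1 / 2 := by
    intro u hu u' hu' hne
    rcases hK2 u hu u' hu' hne with h | h | h <;> rw [h] <;> norm_num
  rcases hε with rfl | rfl
  · -- letter `+1`: the frame `A` itself
    have hT : threeOffsets (-1) = {(0, 0), (1, 0), (0, 1)} := by simp [threeOffsets]
    have hc1 : (fun _ : ℤ => (1 : ℤ)) = constHagg := rfl
    rw [hT, card_filter, sum_insert (by decide), sum_insert (by decide), sum_singleton]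
    push_cast
    simp only [neg_zero, hc1]
    rw [hT] at hraised
    simp only [mem_insert, mem_singleton] at hraised
    obtain ⟨o, ho, hge⟩ := hraised
    rcases ho with rfl | rfl | rfl <;> simp only [neg_zero, hc1] at hge
    · have hc := predSlotBudget_coreR_three_w1 A ν hν haxis t ht K hK3 hK1 hK2' _ _ _ (Or.inl rfl)
        (Or.inl rfl) (Or.inl rfl) hge
      linarith only [hc]
    · have hc := predSlotBudget_coreR_three_w2 A ν hν haxis t ht K hK3 hK1 hK2' _ _ _ (Or.inl rfl)
        (Or.inl rfl) (Or.inl rfl) hge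
      linarith only [hc]
    · have hc := predSlotBudget_coreR_three A ν hν haxis t ht K hK3 hK1 hK2' _ _ _ (Or.inl rfl)
        (Or.inl rfl) (Or.inl rfl) hge
      linarith only [hc]
  · -- letter `−1`: the half-turn frame `A ∘ R_π`
    have hT : threeOffsets (-(-1 : ℤ)) = {(0, 0), (-1, 0), (0, -1)} := by simp [threeOffsets]
    rw [hT, card_filter, sum_insert (by decide), sum_insert (by decide), sum_singleton]
    push_cast
    simp only [neg_zero]
    rw [hT] at hraised
    simp only [mem_insert, mem_singleton] at hraised
    obtain ⟨r₁, r₂, r₃, s₁, s₂, s₃, re⟩ := halfTurn_bonds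
    set R := (((ℝ ∙ (EuclideanSpace.single (2 : Fin 3) (1 : ℝ)))ᗮ.reflection).trans (LinearIsometryEquiv.neg ℝ)) with hR
    have haxis' : ⟪ν, (R.trans A) (EuclideanSpace.single (2 : Fin 3) (1 : ℝ))⟫_ℝ ≤ -(1 / 3) := by
      rw [LinearIsometryEquiv.trans_apply, re]; exact haxis
    have k₁ : A (barlowPos 1 (Real.sqrt (2 / 3)) constHagg 0 1 0) = -(R.trans A) (barlowPos 1 (Real.sqrt (2 / 3)) constHagg 0 1 0) := by
      rw [LinearIsometryEquiv.trans_apply, r₁, map_neg, neg_neg]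
    have k₂ : A (barlowPos 1 (Real.sqrt (2 / 3)) constHagg 0 0 1) = -(R.trans A) (barlowPos 1 (Real.sqrt (2 / 3)) constHagg 0 0 1) := by
      rw [LinearIsometryEquiv.trans_apply, r₂, map_neg, neg_neg]
    have k₃ : A (barlowPos 1 (Real.sqrt (2 / 3)) constHagg 0 1 (-1)) = -(R.trans A) (barlowPos 1 (Real.sqrt (2 / 3)) constHagg 0 1 (-1)) := by
      rw [LinearIsometryEquiv.trans_apply, r₃, map_neg, neg_neg]
    have t₁ : (R.trans A) (barlowPos 1 (Real.sqrt (2 / 3)) constHagg 1 0 0) = A (barlowPos 1 (Real.sqrt (2 / 3)) (fun _ : ℤ => (-1 : ℤ)) 1 0 0) := by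
      rw [LinearIsometryEquiv.trans_apply, s₁]
    have t₂ : (R.trans A) (barlowPos 1 (Real.sqrt (2 / 3)) constHagg 1 (-1) 0) = A (barlowPos 1 (Real.sqrt (2 / 3)) (fun _ : ℤ => (-1 : ℤ)) 1 1 0) := by
      rw [LinearIsometryEquiv.trans_apply, s₂]
    have t₃ : (R.trans A) (barlowPos 1 (Real.sqrt (2 / 3)) constHagg 1 0 (-1)) = A (barlowPos 1 (Real.sqrt (2 / 3)) (fun _ : ℤ => (-1 : ℤ)) 1 0 1) := by
      rw [LinearIsometryEquiv.trans_apply, s₃]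
    obtain ⟨o, ho, hge⟩ := hraised
    rcases ho with rfl | rfl | rfl <;> simp only [neg_zero, neg_neg] at hge
    · have hc := predSlotBudget_coreR_three_w1 (R.trans A) ν hν haxis' t ht K hK3 hK1 hK2' _ _ _ (Or.inr k₁)
        (Or.inr k₂) (Or.inr k₃) (by rw [t₁]; exact hge)
      rw [t₁, t₂, t₃] at hc
      linarith only [hc]
    · have hc := predSlotBudget_coreR_three_w2 (R.trans A) ν hν haxis' t ht K hK3 hK1 hK2' _ _ _ (Or.inr k₁)
        (Or.inr k₂) (Or.inr k₃) (by rw [t₂]; exact hge)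
      rw [t₁, t₂, t₃] at hc
      linarith only [hc]
    · have hc := predSlotBudget_coreR_three (R.trans A) ν hν haxis' t ht K hK3 hK1 hK2' _ _ _ (Or.inr k₁)
        (Or.inr k₂) (Or.inr k₃) (by rw [t₃]; exact hge)
      rw [t₁, t₂, t₃] at hc
      linarith only [hc]

end Summit.Ventures.Crystal3D.Theorems

end
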